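import Literature.MathematicalPhysics.QuantumFieldTheory.Federbush1986.ModeLinearity
import Literature.MathematicalPhysics.QuantumFieldTheory.Federbush1986.AxialTreePureGauge
import Mathlib.Analysis.Calculus.ParametricIntervalIntegral
import Mathlib.MeasureTheory.Measure.Haar.NormedSpace

/-!
# `Federbush1986.RadialGaugePrimitive` — [Federbush1986PhaseCellI] (3.2) p. 327 `A = A^N + ∂Λ`: THE RADIAL (POINCARÉ) GAUGE
# — `K₀ψ ∈ C¹` for `ψ ∈ C¹`, the homotopy identity `ψ − d(K₀ψ) = K(F(ψ))`, and polynomial `L¹` growth of `K(F)` from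
# `∫|F|² < ∞` — PROVED

statement-level skeleton of published theorems with citation tags; proofs where landed; nothing here is a claim about the Yang–Mills mass gap

CITATION HEADER.  P. Federbush, *A phase cell approach to Yang–Mills theory. I*, Commun. Math. Phys. **107** (1986) 319–329
[Federbush1986PhaseCellI]: §3 p. 327 verbatim *«We also require A_μ(x) to minimize the continuum action, subject to the constraint
of having the bond assignments at level r fixed.»* and *«We proceed to find A(x) = A^N_μ(x) minimizing the continuum action and having
prescribed plaquette averages at level 0. … We seek a minimum of the action S, for a Landau gauge A′, a gauge transformation of A.»*,
(3.2) `A_μ(x) = A^N_μ(x) + ∂_μΛ(x)` (the gauge freedom; «A_μ(x) will be a gauge transformation of A^N_μ(x)»), (3.13)–(3.14) p. 328 (exponential decay of the mode and its derivatives), and §0 p. 319–320 (the continuum action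
`∫ Σ_{μ<ν} F²`, gauge invariant).  This module is infrastructure for the constrained minimality of the mode against a GENERAL
`C¹` competitor (the hypothesis `hmin` of `CorrectedMode.modeEstimatesLe_of_field_minimal`): a competitor is only known through
its field strength `F ∈ L²`, and the radial gauge expresses a representative of its gauge orbit through `F` alone.  Unit
`lit-balaban-r17` gen 12; SKELETON rows F1.Eq3.1, F1.Eq3.2-3.12 of `run/shared/lean/pub/lit-balaban/lit-balaban-r17/SKELETON-r17.md`.

THE MATHEMATICS.  (§1) For `ψ ∈ C¹(ℝ⁴; ℝ⁴)` the radial scalar potential `K₀ψ(x) = ∫_0^1 Σ_μ x_μψ_μ(tx) dt` (`scalarPot`) is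
`C¹` with `d(K₀ψ)(x)·v = ∫_0^1 Σ_μ (v_μψ_μ(tx) + t x_μ Dψ_μ(tx)·v) dt` (**`hasFDerivAt_scalarPot`**, **`fderiv_scalarPot_apply`**,
**`contDiff_scalarPot`**: differentiation under the integral sign, Mathlib's `hasFDerivAt_integral_of_dominated_of_fderiv_le`,
domination by the sup of `ψ`, `Dψ` on a ball).  (§2) With `K(ω)(x)_ν = ∫_0^1 tΣ_μ x_μ ω_{μν}(tx) dt` (`vectorPot`) and
`ψ_ν(x) = ∫_0^1 d/dt[tψ_ν(tx)] dt` (FTC, `apply_eq_integral`) one gets the homotopy identity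
`ψ − d(K₀ψ) = K(F(ψ))`, `F_{μν} = ∂_μψ_ν − ∂_νψ_μ` (**`radial_eq_vectorPot`**): the radial-gauge representative
`ψ̃ = radial ψ` of the orbit `ψ + dΛ` is a functional of the field strength.  (§3) `ψ̃` is continuous, its level-0 bond variables
differ from those of `ψ` by the lattice gradient of the unit-box averages of `K₀ψ` (`approxTop_radial`, by the tree's
`approxTop_pureGauge`), so its plaquette variables are those of `ψ` (**`plaqFunctional_radial`**).  (§4) GROWTH: if
`|ω|₁ ≤ M` on `B_1` and `∫|ω|₁² ≤ S` then `∫_{B_r}|K(ω)_ν| ≤ (M+1)V r⁵ + S r⁴` for `r ≥ 1` (**`setIntegral_abs_vectorPot_le`**;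
`V` the volume of the unit ball): `|K(ω)(x)| ≤ ∫_0^1 ‖tx‖|ω(tx)|₁dt`, Fubini on `B_r × (0,1]`, the substitution `y = tx`
(`∫_{B_r} g(tx)dx = t⁻⁴∫_{B_{tr}} g`), and `∫_{B_ρ}‖y‖|ω|₁ ≤ ρ·M·ρ⁴V` for `ρ ≤ 1`, `≤ ρ(ρ⁴V + S)` always (`|ω|₁ ≤ 1 + |ω|₁²`),
so that the inner integral is bounded uniformly in `t` (small `t`: the sup on `B_1`; `t ≥ 1/r`: `t⁻³ ≤ r³`).

WHAT THIS MODULE PROVIDES.  Defs with bodies `scalarPot`, `dIntegrand`, `vectorPot`, `radial`, `boxPot`, `norm1`, `V4`; the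
theorems above.  No `Prop` fact, no `sorry`; axioms standard.
v1.1 (r17 gen 13; DOCFIX of referee asks ref-1 gen 60 and ref-5 gen 46 addendum; declarations untouched): the v1 header quoted as «§3
p. 327 verbatim» a sentence («It is easy to show there is a unique solution minimizing the continuum action subject to this constraint,
e^{ipx}, if one works in the gauge (3.1)») that is on NO page of [Federbush1986PhaseCellI] (pp. 323–329 read: ref-1 g60, ref-5 g46) — it
was a paraphrase; replaced above by the sentences actually printed on p. 327 (render `lit-balaban-r17/renders/fedI/fed1986-cmp107-p009-x2.png`).
-/

namespace Literature.MathematicalPhysics.QuantumFieldTheory.Federbush1986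

open Filter Set MeasureTheory intervalIntegral
open scoped Topology BigOperators Interval

noncomputable section

namespace RadialGauge

open ModeLinearity

variable {ψ : E4 → Fin 4 → ℝ}

/-! ## §1 The radial scalar potential `K₀ψ(x) = ∫_0^1 x·ψ(tx) dt` is `C¹` with the expected differential -/

/-- The radial (Poincaré) scalar potential `K₀ψ(x) = ∫_0^1 Σ_μ x_μ ψ_μ(tx) dt` of a vector potential `ψ`.
[cite: Federbush1986PhaseCellI, (3.2) p. 327 («A_μ(x) = A^N_μ(x) + ∂_μΛ(x)»), §0 p. 320] -/
def scalarPot (ψ : E4 → Fin 4 → ℝ) (x : E4) : ℝ := ∫ t in (0 : ℝ)..1, ∑ μ, x μ * ψ (t • x) μ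

/-- The coordinate projection `x ↦ x_μ` as a continuous linear form. [folklore] -/
private def proj (μ : Fin 4) : E4 →L[ℝ] ℝ := EuclideanSpace.proj μ

/-- Evaluation of the projection. [folklore] -/
@[simp] private theorem proj_apply (μ : Fin 4) (x : E4) : proj μ x = x μ := rfl

/-- The components of a `C¹` potential are `C¹`. [folklore] -/
private theorem contDiff_apply (hψ : ContDiff ℝ 1 ψ) (μ : Fin 4) : ContDiff ℝ 1 fun y => ψ y μ :=
  contDiff_pi.1 hψ μ

/-- The integrand of the differential of `K₀ψ`: `F′(x,t) = Σ_μ (ψ_μ(tx) dx_μ + t x_μ Dψ_μ(tx))`. [cite: Federbush1986PhaseCellI, (3.2) p. 327] -/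
def dIntegrand (ψ : E4 → Fin 4 → ℝ) (x : E4) (t : ℝ) : E4 →L[ℝ] ℝ :=
  ∑ μ, (ψ (t • x) μ • (EuclideanSpace.proj μ : E4 →L[ℝ] ℝ) + (t * x μ) • fderiv ℝ (fun y => ψ y μ) (t • x))

/-- Evaluation of the integrand: `F′(x,t)·v = Σ_μ (v_μ ψ_μ(tx) + t x_μ Dψ_μ(tx)·v)`. [cite: Federbush1986PhaseCellI, (3.2) p. 327] -/
theorem dIntegrand_apply (ψ : E4 → Fin 4 → ℝ) (x : E4) (t : ℝ) (v : E4) :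
    dIntegrand ψ x t v = ∑ μ, (v μ * ψ (t • x) μ + t * x μ * fderiv ℝ (fun y => ψ y μ) (t • x) v) := by
  simp only [dIntegrand, FunLike.coe_sum, Finset.sum_apply, add_apply, FunLike.coe_smul, Pi.smul_apply,
    smul_eq_mul]
  refine Finset.sum_congr rfl fun μ _ => ?_
  simp [mul_comm]

/-- The pointwise differential of the integrand `x ↦ Σ_μ x_μ ψ_μ(tx)`. [cite: Federbush1986PhaseCellI, (3.2) p. 327] -/
theorem hasFDerivAt_integrand (hψ : ContDiff ℝ 1 ψ) (t : ℝ) (x : E4) :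
    HasFDerivAt (fun x : E4 => ∑ μ, x μ * ψ (t • x) μ) (dIntegrand ψ x t) x := by
  unfold dIntegrand
  refine HasFDerivAt.fun_sum fun μ _ => ?_
  have h1 : HasFDerivAt (fun x : E4 => x μ) (proj μ) x := (proj μ).hasFDerivAt
  have h2 : HasFDerivAt (fun x : E4 => ψ (t • x) μ) (t • fderiv ℝ (fun y => ψ y μ) (t • x)) x := by
    have hd := ((contDiff_apply hψ μ).differentiable one_ne_zero (t • x)).hasFDerivAt
    have hc := hd.comp x ((hasFDerivAt_id x).const_smul t)
    have he : (fderiv ℝ (fun y => ψ y μ) (t • x)).comp (t • ContinuousLinearMap.id ℝ E4)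
        = t • fderiv ℝ (fun y => ψ y μ) (t • x) := by
      ext v; simp
    rw [← he]; exact hc
  have h3 := h1.mul h2
  have he : (x μ) • (t • fderiv ℝ (fun y => ψ y μ) (t • x)) + ψ (t • x) μ • proj μ
      = ψ (t • x) μ • (EuclideanSpace.proj μ : E4 →L[ℝ] ℝ) + (t * x μ) • fderiv ℝ (fun y => ψ y μ) (t • x) := by
    rw [add_comm, smul_smul, mul_comm]; rfl
  rw [← he]; exact h3

/-- A uniform bound for the components of `ψ` on a ball. [folklore] -/
private theorem exists_bound_apply (hψ : Continuous ψ) (R : ℝ) :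
    ∃ M, 0 ≤ M ∧ ∀ y ∈ Metric.closedBall (0 : E4) R, ∀ μ, |ψ y μ| ≤ M := by
  obtain ⟨C, hC⟩ := (isCompact_closedBall (0 : E4) R).exists_bound_of_continuousOn hψ.continuousOn
  refine ⟨max C 0, le_max_right _ _, fun y hy μ => ?_⟩
  exact ((norm_le_pi_norm (ψ y) μ).trans (hC y hy)).trans (le_max_left _ _) |> (Real.norm_eq_abs _ ▸ ·)

/-- A uniform bound for the differentials of the components of `ψ` on a ball. [folklore] -/
private theorem exists_bound_fderiv (hψ : ContDiff ℝ 1 ψ) (R : ℝ) :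
    ∃ M, 0 ≤ M ∧ ∀ μ, ∀ y ∈ Metric.closedBall (0 : E4) R, ‖fderiv ℝ (fun y => ψ y μ) y‖ ≤ M := by
  have h : ∀ μ : Fin 4, ∃ C, 0 ≤ C ∧ ∀ y ∈ Metric.closedBall (0 : E4) R, ‖fderiv ℝ (fun y => ψ y μ) y‖ ≤ C := by
    intro μ
    obtain ⟨C, hC⟩ := (isCompact_closedBall (0 : E4) R).exists_bound_of_continuousOn
      (((contDiff_apply hψ μ).continuous_fderiv one_ne_zero).continuousOn)
    exact ⟨max C 0, le_max_right _ _, fun y hy => (hC y hy).trans (le_max_left _ _)⟩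
  choose C hC0 hC using h
  refine ⟨∑ μ, C μ, Finset.sum_nonneg fun μ _ => hC0 μ, fun μ y hy => (hC μ y hy).trans ?_⟩
  exact Finset.single_le_sum (fun ν _ => hC0 ν) (Finset.mem_univ μ)

/-- Norm bound for the integrand of the differential on `[0,1] × B(x₀,1)`. [folklore] -/
private theorem norm_dIntegrand_le (hψ : ContDiff ℝ 1 ψ) (x₀ : E4) :
    ∃ B, ∀ t ∈ Ι (0 : ℝ) 1, ∀ x ∈ Metric.ball x₀ 1, ‖dIntegrand ψ x t‖ ≤ B := by
  set R := ‖x₀‖ + 1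
  obtain ⟨M₀, hM₀, h₀⟩ := exists_bound_apply hψ.continuous R
  obtain ⟨M₁, hM₁, h₁⟩ := exists_bound_fderiv hψ R
  refine ⟨∑ _μ : Fin 4, (M₀ + R * M₁), fun t ht x hx => ?_⟩
  rw [Set.uIoc_of_le zero_le_one] at ht
  have ht0 : 0 ≤ t := ht.1.le
  have ht1 : t ≤ 1 := ht.2
  have hxR : ‖x‖ ≤ R := by
    have := mem_ball_iff_norm.1 hx
    calc ‖x‖ = ‖(x - x₀) + x₀‖ := by rw [sub_add_cancel]
      _ ≤ ‖x - x₀‖ + ‖x₀‖ := norm_add_le _ _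
      _ ≤ R := by linarith
  have htx : t • x ∈ Metric.closedBall (0 : E4) R := by
    rw [Metric.mem_closedBall, dist_zero_right, norm_smul, Real.norm_of_nonneg ht0]
    nlinarith [norm_nonneg x]
  unfold dIntegrand
  refine (norm_sum_le _ _).trans (Finset.sum_le_sum fun μ _ => ?_)
  refine (norm_add_le _ _).trans (add_le_add ?_ ?_)
  · rw [norm_smul, Real.norm_eq_abs]
    have hp : ‖(EuclideanSpace.proj μ : E4 →L[ℝ] ℝ)‖ ≤ 1 := by
      refine ContinuousLinearMap.opNorm_le_bound _ zero_le_one fun v => ?_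
      rw [one_mul]; exact PiLp.norm_apply_le v μ
    calc |ψ (t • x) μ| * ‖(EuclideanSpace.proj μ : E4 →L[ℝ] ℝ)‖ ≤ M₀ * 1 :=
          mul_le_mul (h₀ _ htx μ) hp (norm_nonneg _) hM₀
      _ = M₀ := mul_one _
  · rw [norm_smul, Real.norm_eq_abs, abs_mul, abs_of_nonneg ht0]
    have hxμ : |x μ| ≤ R := (by simpa using PiLp.norm_apply_le x μ : |x μ| ≤ ‖x‖).trans hxR
    calc t * |x μ| * ‖fderiv ℝ (fun y => ψ y μ) (t • x)‖ ≤ 1 * R * M₁ := by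
          refine mul_le_mul (mul_le_mul ht1 hxμ (abs_nonneg _) zero_le_one) (h₁ μ _ htx) (norm_nonneg _) ?_
          positivity
      _ = R * M₁ := by ring

/-- Joint continuity of the integrand of the differential. [folklore] -/
private theorem continuous_dIntegrand (hψ : ContDiff ℝ 1 ψ) :
    Continuous fun p : E4 × ℝ => dIntegrand ψ p.1 p.2 := by
  unfold dIntegrand
  have hsm : Continuous fun p : E4 × ℝ => p.2 • p.1 := continuous_snd.smul continuous_fst
  refine continuous_finsetSum _ fun μ _ => ?_
  refine ((( (contDiff_apply hψ μ).continuous.comp hsm)).smul continuous_const).add ?_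
  exact (continuous_snd.mul ((PiLp.continuous_apply 2 (fun _ : Fin 4 => ℝ) μ).comp continuous_fst)).smul
    (((contDiff_apply hψ μ).continuous_fderiv one_ne_zero).comp hsm)

/-- **`K₀ψ` is differentiable with differential `∫_0^1 F′(x,t) dt`** (differentiation under the integral sign).
[cite: Federbush1986PhaseCellI, (3.2) p. 327] -/
theorem hasFDerivAt_scalarPot (hψ : ContDiff ℝ 1 ψ) (x₀ : E4) :
    HasFDerivAt (scalarPot ψ) (∫ t in (0 : ℝ)..1, dIntegrand ψ x₀ t) x₀ := by
  obtain ⟨B, hB⟩ := norm_dIntegrand_le hψ x₀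
  have hsm : ∀ x : E4, Continuous fun t : ℝ => t • x := fun x => continuous_id.smul continuous_const
  have hFc : ∀ x : E4, Continuous fun t : ℝ => ∑ μ, x μ * ψ (t • x) μ := fun x =>
    continuous_finsetSum _ fun μ _ => continuous_const.mul ((contDiff_apply hψ μ).continuous.comp (hsm x))
  have hF'c : Continuous fun t : ℝ => dIntegrand ψ x₀ t :=
    (continuous_dIntegrand hψ).comp (continuous_const.prodMk continuous_id)
  unfold scalarPot
  exact intervalIntegral.hasFDerivAt_integral_of_dominated_of_fderiv_le (μ := volume) (s := Metric.ball x₀ 1)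
    (F := fun x t => ∑ μ, x μ * ψ (t • x) μ) (F' := fun x t => dIntegrand ψ x t) (bound := fun _ => B)
    (Metric.ball_mem_nhds x₀ one_pos)
    (Filter.Eventually.of_forall fun x => (hFc x).aestronglyMeasurable)
    ((hFc x₀).intervalIntegrable _ _) hF'c.aestronglyMeasurable
    (Filter.Eventually.of_forall fun t ht x hx => hB t ht x hx) intervalIntegrable_const
    (Filter.Eventually.of_forall fun t _ x _ => hasFDerivAt_integrand hψ t x)

/-- The differential of `K₀ψ`. [cite: Federbush1986PhaseCellI, (3.2) p. 327] -/
theorem fderiv_scalarPot (hψ : ContDiff ℝ 1 ψ) (x : E4) :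
    fderiv ℝ (scalarPot ψ) x = ∫ t in (0 : ℝ)..1, dIntegrand ψ x t :=
  (hasFDerivAt_scalarPot hψ x).fderiv

/-- **The differential of `K₀ψ` evaluated**: `d(K₀ψ)(x)·v = ∫_0^1 Σ_μ (v_μ ψ_μ(tx) + t x_μ Dψ_μ(tx)·v) dt`.
[cite: Federbush1986PhaseCellI, (3.2) p. 327] -/
theorem fderiv_scalarPot_apply (hψ : ContDiff ℝ 1 ψ) (x v : E4) :
    fderiv ℝ (scalarPot ψ) x v
      = ∫ t in (0 : ℝ)..1, ∑ μ, (v μ * ψ (t • x) μ + t * x μ * fderiv ℝ (fun y => ψ y μ) (t • x) v) := by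
  have hF'c : Continuous fun t : ℝ => dIntegrand ψ x t :=
    (continuous_dIntegrand hψ).comp (continuous_const.prodMk continuous_id)
  rw [fderiv_scalarPot hψ, ContinuousLinearMap.intervalIntegral_apply (hF'c.intervalIntegrable _ _)]
  simp_rw [dIntegrand_apply]

/-- **`K₀ψ ∈ C¹`.** [cite: Federbush1986PhaseCellI, (3.2) p. 327] -/
theorem contDiff_scalarPot (hψ : ContDiff ℝ 1 ψ) : ContDiff ℝ 1 (scalarPot ψ) := by
  rw [contDiff_one_iff_fderiv]
  refine ⟨fun x => (hasFDerivAt_scalarPot hψ x).differentiableAt, ?_⟩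
  have h : fderiv ℝ (scalarPot ψ) = fun x => ∫ t in (0 : ℝ)..1, dIntegrand ψ x t := funext (fderiv_scalarPot hψ)
  rw [h]
  exact intervalIntegral.continuous_parametric_intervalIntegral_of_continuous (continuous_dIntegrand hψ) continuous_const

/-! ## §2 The homotopy identity `ψ − d(K₀ψ) = K(dψ)` and the radial-gauge representative -/

/-- The radial (Poincaré) vector potential of a 2-form `ω`: `K(ω)(x)_ν = ∫_0^1 t Σ_μ x_μ ω_{μν}(tx) dt`.
[cite: Federbush1986PhaseCellI, (3.2) p. 327, §0 p. 320] -/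
def vectorPot (ω : Fin 4 → Fin 4 → E4 → ℝ) (x : E4) (ν : Fin 4) : ℝ :=
  ∫ t in (0 : ℝ)..1, t * ∑ μ, x μ * ω μ ν (t • x)

/-- **The radial-gauge representative** `ψ̃ = ψ − d(K₀ψ)` of the gauge orbit of `ψ` (a gauge transform (3.2) with `Λ = −K₀ψ`).
[cite: Federbush1986PhaseCellI, (3.2) p. 327] -/
def radial (ψ : E4 → Fin 4 → ℝ) : E4 → Fin 4 → ℝ := fun x ν => ψ x ν - pureGauge (scalarPot ψ) x ν

/-- `x = Σ_μ x_μ e_μ`. [folklore] -/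
private theorem sum_smul_unitVec (x : E4) : ∑ μ, x μ • unitVec μ = x := by
  ext k
  simp [unitVec, Finset.sum_apply, Pi.single_apply]

/-- `Dψ_ν(y)·x = Σ_μ x_μ ∂_μψ_ν(y)`. [cite: Federbush1986PhaseCellI, Estimate 0.2 (0.3) p. 320] -/
theorem fderiv_apply_eq_sum_pd (ψ : E4 → Fin 4 → ℝ) (ν : Fin 4) (y x : E4) :
    fderiv ℝ (fun y => ψ y ν) y x = ∑ μ, x μ * pd ψ μ ν y := by
  conv_lhs => rw [← sum_smul_unitVec x]
  rw [map_sum]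
  refine Finset.sum_congr rfl fun μ _ => ?_
  rw [map_smul, smul_eq_mul]; rfl

/-- `ψ_ν(x) = ∫_0^1 d/dt[tψ_ν(tx)] dt = ∫_0^1 (ψ_ν(tx) + t Σ_μ x_μ ∂_μψ_ν(tx)) dt` (FTC along the ray).
[cite: Federbush1986PhaseCellI, (1.13) p. 324 (line integrals), (3.2) p. 327] -/
theorem apply_eq_integral (hψ : ContDiff ℝ 1 ψ) (x : E4) (ν : Fin 4) :
    ψ x ν = ∫ t in (0 : ℝ)..1, (ψ (t • x) ν + t * ∑ μ, x μ * pd ψ μ ν (t • x)) := by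
  have hψν := contDiff_apply hψ ν
  have hray : ∀ t : ℝ, HasDerivAt (fun t : ℝ => t • x) x t := fun t => by
    simpa using (hasDerivAt_id t).smul_const x
  have hcomp : ∀ t : ℝ, HasDerivAt (fun t : ℝ => ψ (t • x) ν) (fderiv ℝ (fun y => ψ y ν) (t • x) x) t := fun t =>
    ((hψν.differentiable one_ne_zero) _).hasFDerivAt.comp_hasDerivAt t (hray t)
  have hderiv : ∀ t : ℝ, HasDerivAt (fun t : ℝ => t * ψ (t • x) ν)
      (ψ (t • x) ν + t * ∑ μ, x μ * pd ψ μ ν (t • x)) t := by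
    intro t
    have h := (hasDerivAt_id t).mul (hcomp t)
    have h' : ((id : ℝ → ℝ) * fun t => ψ (t • x) ν) = fun t : ℝ => t * ψ (t • x) ν := rfl
    rw [h', fderiv_apply_eq_sum_pd] at h
    simpa only [id_eq, one_mul] using h
  have hcont : Continuous fun t : ℝ => ψ (t • x) ν + t * ∑ μ, x μ * pd ψ μ ν (t • x) := by
    refine (hψν.continuous.comp (continuous_id.smul continuous_const)).add (continuous_id.mul ?_)
    refine continuous_finsetSum _ fun μ _ => continuous_const.mul ?_
    exact ((hψν.continuous_fderiv one_ne_zero).comp (continuous_id.smul continuous_const)).clm_apply continuous_const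
  rw [intervalIntegral.integral_eq_sub_of_hasDerivAt (fun t _ => hderiv t) (hcont.intervalIntegrable _ _)]
  simp

/-- `∂_ν(K₀ψ)(x) = ∫_0^1 (ψ_ν(tx) + t Σ_μ x_μ ∂_νψ_μ(tx)) dt`. [cite: Federbush1986PhaseCellI, (3.2) p. 327] -/
theorem pureGauge_scalarPot (hψ : ContDiff ℝ 1 ψ) (x : E4) (ν : Fin 4) :
    pureGauge (scalarPot ψ) x ν = ∫ t in (0 : ℝ)..1, (ψ (t • x) ν + t * ∑ μ, x μ * pd ψ ν μ (t • x)) := by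
  unfold pureGauge
  rw [fderiv_scalarPot_apply hψ]
  refine intervalIntegral.integral_congr fun t _ => ?_
  have h1 : ∑ μ, (unitVec ν : E4) μ * ψ (t • x) μ = ψ (t • x) ν := by
    simp [unitVec]
  simp only [Finset.sum_add_distrib, h1, Finset.mul_sum]
  congr 1
  refine Finset.sum_congr rfl fun μ _ => ?_
  rw [show fderiv ℝ (fun y => ψ y μ) (t • x) (unitVec ν) = pd ψ ν μ (t • x) from rfl]
  ring

/-- **THE HOMOTOPY IDENTITY**: `ψ − d(K₀ψ) = K(F(ψ))`, i.e. the radial-gauge representative is the radial vector potential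
of the field strength `F_{μν}(ψ) = ∂_μψ_ν − ∂_νψ_μ`. [cite: Federbush1986PhaseCellI, (3.2) p. 327, §0 p. 319–320] -/
theorem radial_eq_vectorPot (hψ : ContDiff ℝ 1 ψ) (x : E4) (ν : Fin 4) :
    radial ψ x ν = vectorPot (fieldStrength ψ) x ν := by
  have hsm : Continuous fun t : ℝ => t • x := continuous_id.smul continuous_const
  have hc0 : Continuous fun t : ℝ => ψ (t • x) ν := (contDiff_apply hψ ν).continuous.comp hsm
  have hpd : ∀ μ ν, Continuous fun t : ℝ => pd ψ μ ν (t • x) := fun μ ν =>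
    (((contDiff_apply hψ ν).continuous_fderiv one_ne_zero).comp hsm).clm_apply continuous_const
  have hc1 : Continuous fun t : ℝ => ψ (t • x) ν + t * ∑ μ, x μ * pd ψ μ ν (t • x) :=
    hc0.add (continuous_id.mul (continuous_finsetSum _ fun μ _ => continuous_const.mul (hpd μ ν)))
  have hc2 : Continuous fun t : ℝ => ψ (t • x) ν + t * ∑ μ, x μ * pd ψ ν μ (t • x) :=
    hc0.add (continuous_id.mul (continuous_finsetSum _ fun μ _ => continuous_const.mul (hpd ν μ)))
  unfold radial vectorPot
  rw [apply_eq_integral hψ x ν, pureGauge_scalarPot hψ x ν,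
    ← intervalIntegral.integral_sub (hc1.intervalIntegrable _ _) (hc2.intervalIntegrable _ _)]
  refine intervalIntegral.integral_congr fun t _ => ?_
  simp only [fieldStrength, mul_sub, Finset.sum_sub_distrib]
  ring

/-! ## §3 The radial representative is continuous and has the bond and plaquette variables of `ψ` up to a lattice gradient -/

/-- `ψ̃` is continuous. [cite: Federbush1986PhaseCellI, (3.2) p. 327, §2 p. 325] -/
theorem continuous_radial (hψ : ContDiff ℝ 1 ψ) : Continuous (radial ψ) := by
  have h1 : Continuous (pureGauge (scalarPot ψ)) := continuous_pureGauge (contDiff_scalarPot hψ)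
  exact continuous_pi fun ν => ((continuous_apply ν).comp hψ.continuous).sub ((continuous_apply ν).comp h1)

/-- The box average of `K₀ψ` at the lattice point `b`. [cite: Federbush1986PhaseCellI, (2.1)–(2.2) p. 325] -/
def boxPot (ψ : E4 → Fin 4 → ℝ) (b : Fin 4 → ℤ) : ℝ := boxAvg 0 (scalarPot ψ) ((⟨b, (0 : Fin 4)⟩ : Edge 0).src)

/-- The base point of an edge does not depend on its direction. [folklore] -/
private theorem src_eq_src (b : Fin 4 → ℤ) (μ : Fin 4) : (⟨b, μ⟩ : Edge 0).src = (⟨b, (0 : Fin 4)⟩ : Edge 0).src := rfl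

/-- **Bond variables of `ψ̃`**: `ψ̃(b, μ) = ψ(b, μ) − (g(b + e_μ) − g(b))`, `g` the box averages of `K₀ψ` (a lattice gradient).
[cite: Federbush1986PhaseCellI, (2.1)–(2.2) p. 325, (4.3) p. 329 («Mirabile dictu»)] -/
theorem approxTop_radial (hψ : ContDiff ℝ 1 ψ) (b : Fin 4 → ℤ) (μ : Fin 4) :
    approxTop 0 (radial ψ) ⟨b, μ⟩ = approxTop 0 ψ ⟨b, μ⟩ - (boxPot ψ (b + Pi.single μ 1) - boxPot ψ b) := by
  have h1 : Continuous (pureGauge (scalarPot ψ)) := continuous_pureGauge (contDiff_scalarPot hψ)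
  have hneg : Continuous ((-1 : ℝ) • pureGauge (scalarPot ψ)) := h1.const_smul _
  have hrad : radial ψ = fun x ν => ψ x ν + ((-1 : ℝ) • pureGauge (scalarPot ψ)) x ν := by
    funext x ν; simp [radial, sub_eq_add_neg]
  rw [hrad, approxTop_add hψ.continuous hneg, approxTop_smul, approxTop_pureGauge (contDiff_scalarPot hψ)]
  unfold boxPot
  rw [src_eq_src, src_eq_src b]
  ring

/-- **`ψ̃` has the plaquette variables of `ψ`** (lattice gradients are invisible to plaquettes).
[cite: Federbush1986PhaseCellI, (1.12)–(1.14) p. 324, §4 p. 329] -/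
theorem plaqFunctional_radial (hψ : ContDiff ℝ 1 ψ) (q : Plaq 0) :
    plaqFunctional 0 (radial ψ) q = plaqFunctional 0 ψ q := by
  rw [← plaqOfBonds_approxTop _ (continuous_radial hψ), ← plaqOfBonds_approxTop _ hψ.continuous]
  obtain ⟨b, i, j⟩ := q
  simp only [plaqOfBonds, approxTop_radial hψ]
  rw [add_right_comm b (Pi.single i 1) (Pi.single j 1)]
  ring

/-! ## §4 Growth of the radial vector potential: `‖K(ω)‖_{L¹(B_r)} ≤ (M+1)V r⁵ + S r⁴` from `sup_{B_1}|ω| ≤ M`, `∫|ω|² ≤ S` -/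

variable {ω : Fin 4 → Fin 4 → E4 → ℝ}

/-- The ℓ¹ size `|ω(y)|₁ = Σ_{μν}|ω_{μν}(y)|` of a 2-form at a point. [cite: Federbush1986PhaseCellI, §0 p. 319–320] -/
def norm1 (ω : Fin 4 → Fin 4 → E4 → ℝ) (y : E4) : ℝ := ∑ μ, ∑ ν, |ω μ ν y|

/-- `|ω|₁ ≥ 0`. [cite: Federbush1986PhaseCellI, §0 p. 319–320] -/
theorem norm1_nonneg (ω : Fin 4 → Fin 4 → E4 → ℝ) (y : E4) : 0 ≤ norm1 ω y :=
  Finset.sum_nonneg fun _ _ => Finset.sum_nonneg fun _ _ => abs_nonneg _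

/-- `|ω|₁` is continuous for continuous `ω`. [cite: Federbush1986PhaseCellI, §0 p. 319–320] -/
theorem continuous_norm1 (hω : ∀ μ ν, Continuous (ω μ ν)) : Continuous (norm1 ω) :=
  continuous_finsetSum _ fun μ _ => continuous_finsetSum _ fun ν _ => (hω μ ν).abs

/-- One component is at most the ℓ¹ size. [cite: Federbush1986PhaseCellI, §0 p. 319–320] -/
theorem abs_le_norm1 (ω : Fin 4 → Fin 4 → E4 → ℝ) (μ ν : Fin 4) (y : E4) : |ω μ ν y| ≤ norm1 ω y := by
  unfold norm1
  calc |ω μ ν y| ≤ ∑ ν', |ω μ ν' y| := Finset.single_le_sum (fun ν' _ => abs_nonneg (ω μ ν' y)) (Finset.mem_univ ν)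
    _ ≤ ∑ μ', ∑ ν', |ω μ' ν' y| :=
        Finset.single_le_sum (fun μ' _ => Finset.sum_nonneg fun ν' _ => abs_nonneg (ω μ' ν' y)) (Finset.mem_univ μ)

/-- The volume of the unit ball of `ℝ⁴` (a positive finite constant; `= π²/2`). [cite: Federbush1986PhaseCellI, §0 p. 319–320] -/
def V4 : ℝ := (volume (Metric.closedBall (0 : E4) 1)).toReal

/-- `V4 ≥ 0`. [cite: Federbush1986PhaseCellI, §0 p. 319–320] -/
theorem V4_nonneg : 0 ≤ V4 := ENNReal.toReal_nonneg

/-- Volume of a ball of radius `ρ` in `ℝ⁴`: `ρ⁴ V4`. [cite: Federbush1986PhaseCellI, §0 p. 319–320] -/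
theorem volume_closedBall_toReal {ρ : ℝ} (hρ : 0 ≤ ρ) : (volume (Metric.closedBall (0 : E4) ρ)).toReal = ρ ^ 4 * V4 := by
  rw [Measure.addHaar_closedBall' volume (0 : E4) hρ, ENNReal.toReal_mul, finrank_euclideanSpace, Fintype.card_fin,
    ENNReal.toReal_ofReal (by positivity)]
  rfl

/-- `K(ω)` is continuous in `x` for continuous `ω`. [cite: Federbush1986PhaseCellI, (3.2) p. 327] -/
theorem continuous_vectorPot (hω : ∀ μ ν, Continuous (ω μ ν)) (ν : Fin 4) : Continuous fun x => vectorPot ω x ν := by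
  unfold vectorPot
  refine intervalIntegral.continuous_parametric_intervalIntegral_of_continuous' ?_ 0 1
  have hsm : Continuous fun p : E4 × ℝ => p.2 • p.1 := continuous_snd.smul continuous_fst
  exact continuous_snd.mul (continuous_finsetSum _ fun μ _ =>
    ((PiLp.continuous_apply 2 (fun _ : Fin 4 => ℝ) μ).comp continuous_fst).mul ((hω μ ν).comp hsm))

/-- **Pointwise bound**: `|K(ω)(x)_ν| ≤ ∫_0^1 ‖tx‖ |ω(tx)|₁ dt`. [cite: Federbush1986PhaseCellI, (3.2) p. 327, (3.13) p. 328] -/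
theorem abs_vectorPot_le (hω : ∀ μ ν, Continuous (ω μ ν)) (x : E4) (ν : Fin 4) :
    |vectorPot ω x ν| ≤ ∫ t in (0 : ℝ)..1, ‖t • x‖ * norm1 ω (t • x) := by
  have hsm : Continuous fun t : ℝ => t • x := continuous_id.smul continuous_const
  have hf : Continuous fun t : ℝ => t * ∑ μ, x μ * ω μ ν (t • x) :=
    continuous_id.mul (continuous_finsetSum _ fun μ _ => continuous_const.mul ((hω μ ν).comp hsm))
  have hg : Continuous fun t : ℝ => ‖t • x‖ * norm1 ω (t • x) :=
    (continuous_norm.comp hsm).mul ((continuous_norm1 hω).comp hsm)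
  unfold vectorPot
  refine (intervalIntegral.abs_integral_le_integral_abs zero_le_one).trans
    (intervalIntegral.integral_mono_on zero_le_one (hf.abs.intervalIntegrable _ _) (hg.intervalIntegrable _ _)
      fun t ht => ?_)
  rw [abs_mul, norm_smul, Real.norm_eq_abs, mul_assoc]
  refine mul_le_mul_of_nonneg_left ?_ (abs_nonneg _)
  calc |∑ μ, x μ * ω μ ν (t • x)| ≤ ∑ μ, |x μ * ω μ ν (t • x)| := Finset.abs_sum_le_sum_abs _ _
    _ ≤ ∑ μ, ‖x‖ * |ω μ ν (t • x)| := Finset.sum_le_sum fun μ _ => by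
        rw [abs_mul]
        exact mul_le_mul_of_nonneg_right (by simpa using PiLp.norm_apply_le x μ) (abs_nonneg _)
    _ = ‖x‖ * ∑ μ, |ω μ ν (t • x)| := (Finset.mul_sum _ _ _).symm
    _ ≤ ‖x‖ * norm1 ω (t • x) := by
        refine mul_le_mul_of_nonneg_left ?_ (norm_nonneg _)
        unfold norm1
        exact Finset.sum_le_sum fun μ _ =>
          Finset.single_le_sum (fun ν' _ => abs_nonneg (ω μ ν' (t • x))) (Finset.mem_univ ν)

/-- The weighted mass of `ω` on a small ball: `∫_{B_ρ} ‖y‖|ω|₁ ≤ ρ·M·ρ⁴V4` for `ρ ≤ 1`, `M = sup_{B_1}|ω|₁`.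
[cite: Federbush1986PhaseCellI, (3.13) p. 328] -/
theorem setIntegral_weight_le_small (hω : ∀ μ ν, Continuous (ω μ ν)) {M : ℝ}
    (hM : ∀ y ∈ Metric.closedBall (0 : E4) 1, norm1 ω y ≤ M) {ρ : ℝ} (hρ0 : 0 ≤ ρ) (hρ1 : ρ ≤ 1) :
    ∫ y in Metric.closedBall (0 : E4) ρ, ‖y‖ * norm1 ω y ≤ ρ * M * (ρ ^ 4 * V4) := by
  have hcont : Continuous fun y : E4 => ‖y‖ * norm1 ω y := continuous_norm.mul (continuous_norm1 hω)
  calc ∫ y in Metric.closedBall (0 : E4) ρ, ‖y‖ * norm1 ω y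
      ≤ ∫ _y in Metric.closedBall (0 : E4) ρ, ρ * M := by
        refine setIntegral_mono_on (hcont.continuousOn.integrableOn_compact (isCompact_closedBall _ _))
          (continuous_const.continuousOn.integrableOn_compact (isCompact_closedBall _ _)) measurableSet_closedBall
          fun y hy => ?_
        have hy' : ‖y‖ ≤ ρ := by simpa using hy
        have hy1 : y ∈ Metric.closedBall (0 : E4) 1 := Metric.closedBall_subset_closedBall hρ1 hy
        exact mul_le_mul hy' (hM y hy1) (norm1_nonneg _ _) hρ0
    _ = ρ * M * (ρ ^ 4 * V4) := by
        rw [setIntegral_const, measureReal_def, volume_closedBall_toReal hρ0, smul_eq_mul]; ring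

/-- The weighted mass of `ω` on any ball: `∫_{B_ρ} ‖y‖|ω|₁ ≤ ρ(ρ⁴V4 + S)`, `S ≥ ∫|ω|₁²` (from `|ω|₁ ≤ 1 + |ω|₁²`).
[cite: Federbush1986PhaseCellI, (3.13) p. 328] -/
theorem setIntegral_weight_le_large (hω : ∀ μ ν, Continuous (ω μ ν)) {S : ℝ}
    (hint : Integrable fun y => norm1 ω y ^ 2) (hS : ∫ y, norm1 ω y ^ 2 ≤ S) {ρ : ℝ} (hρ0 : 0 ≤ ρ) :
    ∫ y in Metric.closedBall (0 : E4) ρ, ‖y‖ * norm1 ω y ≤ ρ * (ρ ^ 4 * V4 + S) := by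
  have hcont : Continuous fun y : E4 => ‖y‖ * norm1 ω y := continuous_norm.mul (continuous_norm1 hω)
  have hK : IsCompact (Metric.closedBall (0 : E4) ρ) := isCompact_closedBall _ _
  have hint2 : IntegrableOn (fun y => ρ * (1 + norm1 ω y ^ 2)) (Metric.closedBall (0 : E4) ρ) :=
    (continuous_const.mul (continuous_const.add ((continuous_norm1 hω).pow 2))).continuousOn.integrableOn_compact hK
  calc ∫ y in Metric.closedBall (0 : E4) ρ, ‖y‖ * norm1 ω y
      ≤ ∫ y in Metric.closedBall (0 : E4) ρ, ρ * (1 + norm1 ω y ^ 2) := by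
        refine setIntegral_mono_on (hcont.continuousOn.integrableOn_compact hK) hint2 measurableSet_closedBall
          fun y hy => ?_
        have hy' : ‖y‖ ≤ ρ := by simpa using hy
        have h1 : norm1 ω y ≤ 1 + norm1 ω y ^ 2 := by nlinarith [norm1_nonneg ω y, sq_nonneg (norm1 ω y - 1)]
        exact mul_le_mul hy' h1 (norm1_nonneg _ _) hρ0
    _ = ρ * ((volume (Metric.closedBall (0 : E4) ρ)).toReal + ∫ y in Metric.closedBall (0 : E4) ρ, norm1 ω y ^ 2) := by
        have hc1 : IntegrableOn (fun _ : E4 => (1 : ℝ)) (Metric.closedBall (0 : E4) ρ) :=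
          integrableOn_const (hK.measure_lt_top.ne)
        have hadd : ∫ y in Metric.closedBall (0 : E4) ρ, (1 + norm1 ω y ^ 2)
            = (∫ _y in Metric.closedBall (0 : E4) ρ, (1 : ℝ)) + ∫ y in Metric.closedBall (0 : E4) ρ, norm1 ω y ^ 2 :=
          MeasureTheory.integral_add hc1 hint.integrableOn
        rw [MeasureTheory.integral_const_mul, hadd, setIntegral_const, measureReal_def, smul_eq_mul, mul_one]
    _ ≤ ρ * (ρ ^ 4 * V4 + S) := by
        rw [volume_closedBall_toReal hρ0]
        refine mul_le_mul_of_nonneg_left (add_le_add le_rfl ?_) hρ0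
        exact (setIntegral_le_integral hint (Eventually.of_forall fun y => sq_nonneg _)).trans hS

/-- **The scaled inner integral is uniformly bounded**: for `t ∈ (0,1]` and `r ≥ 1`,
`∫_{B_r} ‖tx‖|ω(tx)|₁ dx ≤ (M+1)V4 r⁵ + S r⁴` (substitute `y = tx`; small `t` uses `sup_{B_1}`, large `t` uses `∫|ω|₁²`).
[cite: Federbush1986PhaseCellI, (3.13) p. 328] -/
theorem setIntegral_scaled_weight_le (hω : ∀ μ ν, Continuous (ω μ ν)) {M S : ℝ} (hM0 : 0 ≤ M)
    (hM : ∀ y ∈ Metric.closedBall (0 : E4) 1, norm1 ω y ≤ M)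
    (hint : Integrable fun y => norm1 ω y ^ 2) (hS : ∫ y, norm1 ω y ^ 2 ≤ S) {r : ℝ} (hr : 1 ≤ r)
    {t : ℝ} (ht0 : 0 < t) (ht1 : t ≤ 1) :
    ∫ x in Metric.closedBall (0 : E4) r, ‖t • x‖ * norm1 ω (t • x) ≤ (M + 1) * V4 * r ^ 5 + S * r ^ 4 := by
  have hS0 : 0 ≤ S := (integral_nonneg fun y => sq_nonneg _).trans hS
  have hr0 : 0 ≤ r := zero_le_one.trans hr
  have hV := V4_nonneg
  -- substitution `y = t x`
  have hsub : ∫ x in Metric.closedBall (0 : E4) r, ‖t • x‖ * norm1 ω (t • x)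
      = (t ^ 4)⁻¹ * ∫ y in Metric.closedBall (0 : E4) (t * r), ‖y‖ * norm1 ω y := by
    rw [Measure.setIntegral_comp_smul_of_pos volume (fun y : E4 => ‖y‖ * norm1 ω y) (Metric.closedBall (0 : E4) r) ht0,
      finrank_euclideanSpace, Fintype.card_fin, smul_eq_mul, smul_closedBall _ _ hr0, smul_zero,
      Real.norm_of_nonneg ht0.le]
  rw [hsub]
  have ht4 : 0 < t ^ 4 := by positivity
  by_cases htr : t * r ≤ 1
  · -- small ball inside `B_1`
    have h1 := setIntegral_weight_le_small hω hM (by positivity : 0 ≤ t * r) htr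
    calc (t ^ 4)⁻¹ * ∫ y in Metric.closedBall (0 : E4) (t * r), ‖y‖ * norm1 ω y
        ≤ (t ^ 4)⁻¹ * (t * r * M * ((t * r) ^ 4 * V4)) := mul_le_mul_of_nonneg_left h1 (by positivity)
      _ = M * V4 * r ^ 5 * t := by field_simp
      _ ≤ M * V4 * r ^ 5 * 1 := mul_le_mul_of_nonneg_left ht1 (by positivity)
      _ ≤ (M + 1) * V4 * r ^ 5 + S * r ^ 4 := by nlinarith [pow_nonneg hr0 5, pow_nonneg hr0 4]
  · -- large `t ≥ 1/r`
    push Not at htr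
    have hinv : t⁻¹ ≤ r := by
      rw [inv_le_iff_one_le_mul₀ ht0, mul_comm]; exact htr.le
    have h1 := setIntegral_weight_le_large hω hint hS (by positivity : 0 ≤ t * r)
    calc (t ^ 4)⁻¹ * ∫ y in Metric.closedBall (0 : E4) (t * r), ‖y‖ * norm1 ω y
        ≤ (t ^ 4)⁻¹ * (t * r * ((t * r) ^ 4 * V4 + S)) := mul_le_mul_of_nonneg_left h1 (by positivity)
      _ = V4 * r ^ 5 * t + S * r * t⁻¹ ^ 3 := by field_simp
      _ ≤ V4 * r ^ 5 * 1 + S * r * r ^ 3 := by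
          refine add_le_add (mul_le_mul_of_nonneg_left ht1 (by positivity)) (mul_le_mul_of_nonneg_left ?_ (by positivity))
          exact pow_le_pow_left₀ (inv_nonneg.2 ht0.le) hinv 3
      _ ≤ (M + 1) * V4 * r ^ 5 + S * r ^ 4 := by nlinarith [pow_nonneg hr0 5, mul_nonneg hM0 hV]

/-- **GROWTH OF THE RADIAL VECTOR POTENTIAL**: if `|ω|₁ ≤ M` on the unit ball and `∫|ω|₁² ≤ S`, then for `r ≥ 1`
`∫_{B_r} |K(ω)_ν| ≤ (M+1)V4 r⁵ + S r⁴` — polynomial growth, the input for cutting off the radial-gauge representative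
against exponentially decaying multipliers and field strengths (3.13). [cite: Federbush1986PhaseCellI, (3.2) p. 327, (3.13) p. 328] -/
theorem setIntegral_abs_vectorPot_le (hω : ∀ μ ν, Continuous (ω μ ν)) {M S : ℝ} (hM0 : 0 ≤ M)
    (hM : ∀ y ∈ Metric.closedBall (0 : E4) 1, norm1 ω y ≤ M)
    (hint : Integrable fun y => norm1 ω y ^ 2) (hS : ∫ y, norm1 ω y ^ 2 ≤ S) {r : ℝ} (hr : 1 ≤ r) (ν : Fin 4) :
    ∫ x in Metric.closedBall (0 : E4) r, |vectorPot ω x ν| ≤ (M + 1) * V4 * r ^ 5 + S * r ^ 4 := by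
  set P : ℝ := (M + 1) * V4 * r ^ 5 + S * r ^ 4 with hP
  set Bx := Metric.closedBall (0 : E4) r with hBx
  have hK : IsCompact Bx := isCompact_closedBall _ _
  -- the jointly continuous weight `g(x,t) = ‖tx‖ |ω(tx)|₁`
  set g : E4 → ℝ → ℝ := fun x t => ‖t • x‖ * norm1 ω (t • x) with hg
  have hgc : Continuous (Function.uncurry g) := by
    have hsm : Continuous fun p : E4 × ℝ => p.2 • p.1 := continuous_snd.smul continuous_fst
    exact (continuous_norm.comp hsm).mul ((continuous_norm1 hω).comp hsm)
  have hg0 : ∀ x t, 0 ≤ g x t := fun x t => mul_nonneg (norm_nonneg _) (norm1_nonneg _ _)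
  -- Step 1: pointwise domination and integrability of the dominating function on the ball
  have hh : Continuous fun x : E4 => ∫ t in (0 : ℝ)..1, g x t :=
    intervalIntegral.continuous_parametric_intervalIntegral_of_continuous' hgc 0 1
  have step1 : ∫ x in Bx, |vectorPot ω x ν| ≤ ∫ x in Bx, ∫ t in (0 : ℝ)..1, g x t :=
    integral_mono_of_nonneg (Eventually.of_forall fun x => abs_nonneg _) (hh.continuousOn.integrableOn_compact hK)
      (Eventually.of_forall fun x => abs_vectorPot_le hω x ν)
  refine step1.trans ?_
  -- Step 2: Fubini on `Bx × (0,1]`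
  have hprod : Integrable (Function.uncurry g) ((volume.restrict Bx).prod (volume.restrict (Ioc (0 : ℝ) 1))) := by
    rw [Measure.prod_restrict]
    exact (hgc.continuousOn.integrableOn_compact (hK.prod isCompact_Icc)).mono_set (prod_mono le_rfl Ioc_subset_Icc_self)
  have step2 : ∫ x in Bx, ∫ t in (0 : ℝ)..1, g x t = ∫ t in Ioc (0 : ℝ) 1, ∫ x in Bx, g x t := by
    simp_rw [intervalIntegral.integral_of_le zero_le_one]
    exact integral_integral_swap hprod
  rw [step2]
  -- Step 3: the inner integral is bounded by `P` for every `t ∈ (0,1]`, and is non-negative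
  have step3 : ∀ t ∈ Ioc (0 : ℝ) 1, ∫ x in Bx, g x t ≤ P := fun t ht =>
    setIntegral_scaled_weight_le hω hM0 hM hint hS hr ht.1 ht.2
  calc ∫ t in Ioc (0 : ℝ) 1, ∫ x in Bx, g x t ≤ ∫ _t in Ioc (0 : ℝ) 1, P := by
        refine integral_mono_of_nonneg (Eventually.of_forall fun t => setIntegral_nonneg measurableSet_closedBall
          fun x _ => hg0 x t) (integrableOn_const (by simp)) ?_
        exact (ae_restrict_iff' measurableSet_Ioc).2 (Eventually.of_forall step3)
    _ = P := by simp

end RadialGauge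

end

end Literature.MathematicalPhysics.QuantumFieldTheory.Federbush1986
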